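import Summits.QuantumFields.YangMills.Theses.ConvexGribovBody
import Summits.QuantumFields.YangMills.Theses.SmallCircleAnchor
import Summits.QuantumFields.YangMills.Theses.HyperbolicRegulator
import Summits.QuantumFields.YangMills.Theses.ContractibleFibre
import Summits.QuantumFields.YangMills.Theses.EquipartitionCriticality
import Summits.QuantumFields.YangMills.Theorems.ConvexGribovBodyContinuumLegGivenGapDock
import Summits.QuantumFields.YangMills.Theorems.ConvexGribovBodyContinuumLegGivenGapThreshold
import Summits.QuantumFields.YangMills.Theorems.ConvexGribovBodyContinuumLegGivenGapStubAlongSequence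
import Summits.QuantumFields.YangMills.Theorems.ConvexGribovBodyContinuumLegGivenGapStubFluxSocket
import Summits.QuantumFields.YangMills.Theorems.FradkinShenkerFlowClusteringToYangMillsDominance
import Summits.QuantumFields.YangMills.Theorems.ClusteringToYangMills.Negative.AdapterNonSoftness
import Summits.QuantumFields.YangMills.Theorems.ClusteringToYangMills.Negative.AdapterCover
import Summits.QuantumFields.YangMills.Theorems.HypercubicLimit.Negative.NonabelianLoadBearing
import Summits.QuantumFields.YangMills.Theorems.HypercubicLimit.Negative.AllTimesGapFalse
import Summits.QuantumFields.YangMills.Theorems.ContinuumLegGivenGap.Negative.LinearLoadBearing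
import Summits.QuantumFields.QCD.Theorems.YangMills.Negative.WithoutLinear

/-!
# Disproof of `ContinuumLegGivenGap` (stmt-QuantumFields-15828) — standing adversary work file (cdisprove, gen 2, cycle 1)

Crux item `stmt-QuantumFields-15828` = `Summit.QuantumFields.YangMills.Theses.ConvexGribovBody.ContinuumLegGivenGap`,
the 2026-08-16 RE-TYPE of stmt-8782 (conclusion now `sch.HasWeakCouplingLimit ∧ …`); character-identical twins
`SmallCircleAnchor.ContinuumLegGivenGap` (r4), `HyperbolicRegulator.ContinuumLegGivenGap` (r5),
`ContractibleFibre.WeakCouplingContinuumLeg` (r5) — `twins_iff`.  Gen 1 of this file (52 KB, typed on 8782) no longer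
elaborates against the tree; this is its port + the re-type delta + the answer to the reshape-7 lead's
`disprover-wanted: stub_lock`.  Prose lives only in docstrings; every `theorem` is checked (rc 0); `sorry` appears ONLY
in §5 (two near-misses, each with its obstruction).

The crux reads (`crux_iff`, definitional): for every compact simple `G` with its Borel σ-algebra,
`GapHyp G → Concl G`, `GapHyp G := ∀ r : LatticeRep G, GapHypAt G r` (per-β rate, per-β threshold, per-pair
constants — UNCHANGED), `Concl G` := the body of `YangMills` at `G` (NOW: `∃ r sch T, sch.HasWeakCouplingLimit ∧
IsYangMillsFor r sch T ∧ IsNontrivial ∧ IsNonGaussian ∧ ∃ Δ > 0, T.HasMassGap Δ ∧ HasLatticeMassGap r sch Δ`).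

## VERDICT (gen 2, cycle 1): the CRUX RESISTS; nothing in reshape 7 is refutable here; `stub_lock` is not soft

`not_crux_iff` : `¬ crux ↔ ∃ G compact simple, GapHyp G ∧ ¬ Concl G` — a disproof must PROVE the volume-uniform
weak-coupling lattice gap of Wilson's theory for one compact simple Lie group in EVERY faithful `r` (open) AND REFUTE
Clay's statement for that `G` as typed (believed true).  No junk `G` (`IsCompactSimpleLieGroup` ⇒ compact simple LIE
group), no junk in `GapHyp` (§1), none in `Concl` surviving `IsNontrivial` (§2).  The re-type makes the crux STRONGER
(more refutable in principle): it now contains sequential criticality for some faithful `r` (§5 NEAR-MISS 3, B3), but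
the frozen-ξ scenario that would bite is Chatterjee's Problem 5.1 negated — unbelieved and unconstructible.

## TREE ROT NOTICE (found while porting; for the operator / planners)
The statement re-type p116790 silently broke Theorems files whose SOURCE spells the old `Concl`/`YangMills` shape
against a decl by name; the farm still serves their stale oleans, so imports "work" until the next full rebuild:
`Theorems/ContinuumLegGivenGap/Negative/PerGroupBurden.lean` (line 115, `exists_gapHyp_not_concl_of_not_continuumLegGivenGap`),
`Theorems/ClusteringToYangMills/Negative/DisproofBurden.lean` (lines 248/251, `yangMills_witness_beta_ne_zero`),
`Theorems/HypercubicLimit/Negative/BetaMustLeaveZero.lean` (line 103, `PencilRigidity.HypercubicLimit` gone).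
Verified by re-elaborating the sources (folder `X1.lean`, `fresh/T_*.lean`).  This file and the gen-2 Negative files
import NONE of them (fresh-at-source modules only).  A repaired `PerGroupBurden.lean` bounces `theorems.append-only`
(the burden theorem's statement must change, its old statement is unprovable now): wedged — reported with the repaired
source as item evidence (`TREE-ROT.md`, `PerGroupBurden_repaired.lean`) for the operator.

LANDED by this seat (prover-importable, `--supports stmt-QuantumFields-15828`, namespace
`Summit.QuantumFields.YangMills.Theorems.ContinuumLegGivenGap.Negative`):
* `Theorems/ContinuumLegGivenGap/Negative/WeakCouplingDelta.lean` — p122023 ACCEPTED, commit 427da0f9b93b: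
  `hasWeakCouplingLimit_vacuum_witness`, `conclMinus_iff_seqLatticeGap`, `seqLatticeGap_of_gapHyp`,
  `conclMinus_of_gapHyp`, `continuumLegGivenGap_minus_nontriviality`, `abstract_lock_false`, `osNorm_constants`,
  `symmetric_moment_logConvex` (§2–§3 below, def-free forms).
* `Theorems/ContinuumLegGivenGap/Negative/PerGroupBurdenWeak.lean` — p122141 ACCEPTED, commit 209f118df64a:
  `exists_gapHyp_not_concl_weak_of_not_continuumLegGivenGap`, `continuumLegGivenGap_weak_false_without_nonabelian`,
  `continuumLegGivenGap_weak_false_without_linear` (§0, §2 below, re-typed shapes).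

## Index of findings (all proved unless marked §5)

* §0 ANATOMY — `GapHypAt`, `EC` (= `∃ m > 0, TorusClusteringAt`), `ConclMinus` (Concl without the two interacting
  clauses), `SeqLatticeGap` (its lattice shadow), `Concl`; `twins_iff`, `crux_iff`, `yangMills_iff`,
  `crux_of_yangMills`, `cruxAt_of_not_gapHyp`, `not_crux_iff`, `gapHyp_of_not_crux`, `not_yangMills_of_not_crux`,
  `clusteringToYangMills_of_crux` / `not_crux_of_not_clusteringToYangMills` (15828 ⇒ 9443),
  `criticalContinuumLimit_of_crux` (15828 ⇒ re-typed hub 15940), `crux_iff_yangMills_of_uniformLatticeGap`,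
  `crux_iff_yangMills_of_cut` (under the route's rev-5 π₁-cut the crux IS the summit).
* §1 THE HYPOTHESIS (unchanged by the re-type): `gapHypAt_iff_ec` (thresholds cosmetic, landed
  `gapHyp_iff_torusClusteringAt`), `ec_perVolume` + `cruxPerVolume_iff_yangMills` (`∀ S ∃ C` is contentless),
  `not_ecAllTimes_threshold` + `cruxAllTimes_trivial` (dropping `n ≤ S` makes the hypothesis false for every
  non-abelian `G`), `latticeConnectedCorr_subsingleton`, `gapHypAt_of_subsingleton`.
* §2 THE CONCLUSION — RE-TYPE DELTA:
  - `hwc_vacuum_witness`: `HasWeakCouplingLimit` ALONE is not load-bearing against the vacuum (weak vacuum scheme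
    `β_k = k`, `c ≡ 0`: HWC ∧ IsYangMillsFor ∧ every continuum gap ∧ ¬IsNontrivial ∧ ¬IsNonGaussian);
    `boundedCoupling_dead`: gen 1's free witness (`β ≡ 0`) is dead.
  - `conclMinus_iff_seqLatticeGap`: Concl-minus-non-triviality at `(G, r)` is EXACTLY a sequential weak-coupling
    volume-uniform lattice gap in physical units; `seqLatticeGap_of_gapHypAt` (NEW: `GapHyp` is now CONSUMED —
    softly, by the landed `stub_alongSequence` + free spacings `a_k := min(1/(k+1), m_k)`), `conclMinus_of_gapHypAt`,
    `cruxMinusNontriviality_holds` (the crux minus the interacting clauses is a THEOREM whose proof uses the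
    hypothesis), `exists_conclMinus_iff_exists_seqLatticeGap`, `seqLatticeGap_of_concl`.  MORAL: the rate sacrifice
    is absorbed by the FREE spacings, i.e. by giving up any relation between `a_k` and the physical correlation
    length — precisely the freedom the interacting clauses remove (ultralocality).  All difficulty: `IsNontrivial ∧
    IsNonGaussian` at `β_k → ∞` with `a_k` pinned to `ξ(β_k)⁻¹`.  MUTATION: `seqLatticeGap_of_seqGapHyp` /
    `conclMinus_of_seqGapHyp` — clustering along ANY sequence `β_j → ∞` already suffices for the soft part; the tail
    `∀ β ≥ β₀` can matter only for the interacting clauses (criticality as lim vs liminf).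
  - `not_concl_of_subsingleton`, `crux_false_without_nonabelian` (PUnit), `crux_false_without_linear` (D₃
    indiscrete): non-abelianness and linearity stay load-bearing in the re-typed shape.
* §3 `-- Targets` (reshape 7, `disprover-wanted: stub_lock`): `abstract_lock_false` (+ `plateau*`,
  `abstract_lock_sharp`): without positivity, GapHyp-shaped data continuous in `β` with a common sharp rate admit
  k-uniform constants along NO sequence at ANY rate bounded below — `stub_lock` is not soft; `osNorm_constants`,
  `symmetric_moment_logConvex`, `plateau_not_logConvex`: with transfer-matrix structure the constants are free at
  the exact rate and the plateau is excluded — so `stub_lock` is not refutable by RP-compatible abstract data either;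
  its content is the TORUS thermal window / multiplicity at `n ≤ S` (ideator-1 B2), where I have no model of
  Wilson's theory misbehaving along every sequence.  Verdict for the lead: keep SHARP in the stub, expect the proof
  to be the finite-size core (9443 class); the factor `4` is slack, not forced.
* §5 NEAR-MISSES (sorried): `gapHyp_su2` (lattice IR gap of SU(2)); `frozen_fatal_nearMiss` (B3: frozen lattice gap
  in OS form along the scheme ⇒ ¬IsNontrivial; roadmap + the equicontinuity obstruction = a (UVB)-type k-uniform
  OS-norm bound; `frozen_step_one` is the only trivial step).  Gen 1's NEAR-MISS 2 (`β_k → ∞` for every witness) is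
  RESOLVED BY FIAT: the re-type assumes it.

## Regimes / attacks tried (gen 2) — all dead, with the reason
1. Junk `G`: none (unchanged).  2. Junk in `GapHyp`: unchanged (§1).  3. Junk in the NEW clause: `Tendsto β atTop
atTop` is honest (no `ℝ`-junk; bounded schemes excluded, `boundedCoupling_dead`); it does not interact with
`IsYangMillsFor` (which never reads `β` beyond the measure) — `hwc_vacuum_witness`.  4. Can `ConclMinus` now FAIL
(making the crux refutable through the lattice clause alone)?  No: `GapHyp ⇒ SeqLatticeGap` (§2), so at any `G`
where the hypothesis holds the lattice clauses are satisfiable; the crux can only fail through the interacting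
clauses.  5. Interacting clauses at `β → ∞`: triviality of 4d YM is not a theorem (asymptotic freedom says the
opposite); the duality selection rule (ideator-1 B1) kills only the TREE-level three-point function of the six-plane
density, not `IsNonGaussian`.  6. Barrier catalogue: FixedCouplingUltralocality now bears on every witness (β_k → ∞
pins the UV fixed point; a frozen ξ would make every limit ultralocal) — §5 NM3 records what a typed version needs;
UVStabilityNonUniqueness constrains proofs only.  7. `ledger negatives --problem QuantumFields`: nothing of this
shape.  8. Reshape-7 stubs: `stub_lock` analysed (§3); `stub_uvPackage`/`stub_skewWindow` are open-problem class
with no small model; `stub_critical`/`stub_witness` are provable bookkeeping (nothing to refute).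

## WHY IT RESISTS (for the provers)
Refuting = lattice IR gap for one simple `G` (all `r`) + ¬Clay for that `G`.  Proving = the continuum programme at
`β_k → ∞`: lock the rate (finite-size core, RP), criticality `m̂_k → 0` (XiDiverges), UV package at the intrinsic
unit (Bałaban/MRS class), non-Gaussianity of `tr F²` (NLO skewness window), rotations.  §2 shows `GapHyp` feeds only
the scale and the lattice-gap clause; §3 that the IR lock is neither soft nor abstractly refutable.
-/

noncomputable section

namespace Summit.QuantumFields.YangMills.Cruxes.ContinuumLegGivenGap.Disproof

open scoped SchwartzMap
open Filter Topology MeasureTheory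
open Literature.MathematicalPhysics.AQFT Literature.MathematicalPhysics.QuantumLattice
open Literature.MathematicalPhysics.QuantumFieldTheory
open Summit.QuantumFields.YangMills.Theses
open Summit.QuantumFields.YangMills.Theorems
open Summit.QuantumFields.YangMills.Theorems.HypercubicLimit.Negative
open Summit.QuantumFields.YangMills.Theorems.ClusteringToYangMills.Negative

/-! ## §0 Anatomy: the crux is `∀ G, GapHyp G → Concl G`, `Concl` now WITH `HasWeakCouplingLimit` -/

section Vocabulary

variable {G : Type} [Group G] [TopologicalSpace G] [IsTopologicalGroup G] [CompactSpace G]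
  [MeasurableSpace G] [BorelSpace G]

variable (G) in
/-- **`GapHypAt G r`** — the crux's hypothesis at one `(G, r)` (UNCHANGED by the re-type): above `β₀`, at each
`β` some rate `m > 0`, some volume threshold `S₁` and per-pair constants. [folklore] -/
def GapHypAt (r : LatticeRep G) : Prop :=
  ∃ β₀ : ℝ, ∀ β : ℝ, β₀ ≤ β → ∃ m : ℝ, 0 < m ∧ ∃ S₁ : ℕ, ∀ A B : YMSpecies G, ∃ C : ℝ,
    ∀ S n : ℕ, S₁ ≤ S → n ≤ S →
      |latticeConnectedCorr r.ρ β (2 * S + 1) A.F B.F n| ≤ C * Real.exp (-(m * n))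

variable (G) in
/-- **`EC G r β`** — the threshold-free shape at one coupling (= the tree's `TorusClusteringAt r β m` with the
rate existentially bound). [folklore] -/
def EC (r : LatticeRep G) (β : ℝ) : Prop :=
  ∃ m : ℝ, 0 < m ∧ TorusClusteringAt r β m

variable (G) in
/-- **`ConclMinus G r`** — the crux's conclusion at `(G, r)` with the two non-triviality clauses DELETED:
a weak-coupling scheme, OS data tied to the lattice, a continuum gap and the uniform lattice gap. [folklore] -/
def ConclMinus (r : LatticeRep G) : Prop :=
  ∃ (sch : SpeciesScheme (YMSpecies G)) (T : OSData (YMSpecies G) 4),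
    sch.HasWeakCouplingLimit ∧ IsYangMillsFor r sch T ∧ ∃ Δ > 0, T.HasMassGap Δ ∧ HasLatticeMassGap r sch Δ

variable (G) in
/-- **`SeqLatticeGap G r`** — what `ConclMinus` says about the lattice alone: spacings `a_k → 0⁺`, couplings
`β_k → +∞`, half-sides `L_k` with `a_k L_k → ∞`, and ONE constant per pair of local observables such that for all
large `k`, on every torus `S ≥ L_k`, `n ≤ S`: `|corr_{β_k,2S+1}(A,B;n)| ≤ C e^{−Δ a_k n}` for some `Δ > 0` — a
SEQUENTIAL weak-coupling volume-uniform lattice gap in physical units (the scheme's renormalisations play no role).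
[folklore] -/
def SeqLatticeGap (r : LatticeRep G) : Prop :=
  ∃ (a : ℕ → ℝ) (β : ℕ → ℝ) (L : ℕ → ℕ), (∀ k, 0 < a k) ∧ Tendsto a atTop (𝓝 0) ∧
    Tendsto (fun k => a k * L k) atTop atTop ∧ Tendsto β atTop atTop ∧
    ∃ Δ > 0, ∀ A B : YMSpecies G, ∃ C : ℝ, ∀ᶠ k in atTop, ∀ S : ℕ, L k ≤ S → ∀ n : ℕ, n ≤ S →
      |latticeConnectedCorr r.ρ (β k) (2 * S + 1) A.F B.F n| ≤ C * Real.exp (-(Δ * (a k * n)))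

variable (G) in
/-- **`Concl G`** — the crux's conclusion at `G` = the body of `YangMills` at `G` (re-typed 2026-08-16:
`sch.HasWeakCouplingLimit ∧ …`). [folklore] -/
def Concl : Prop :=
  ∃ (r : LatticeRep G) (sch : SpeciesScheme (YMSpecies G)) (T : OSData (YMSpecies G) 4),
    sch.HasWeakCouplingLimit ∧ IsYangMillsFor r sch T ∧ T.IsNontrivial r.curvature ∧
      T.IsNonGaussian r.curvature ∧ ∃ Δ > 0, T.HasMassGap Δ ∧ HasLatticeMassGap r sch Δ

end Vocabulary

section Anatomy

/-- The four route declarations of the shared item are ONE proposition (ConvexGribovBody r5, SmallCircleAnchor r4,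
HyperbolicRegulator r5, ContractibleFibre r5 `WeakCouplingContinuumLeg`). [folklore] -/
theorem twins_iff :
    (SmallCircleAnchor.ContinuumLegGivenGap ↔ ConvexGribovBody.ContinuumLegGivenGap) ∧
    (HyperbolicRegulator.ContinuumLegGivenGap ↔ ConvexGribovBody.ContinuumLegGivenGap) ∧
    (ContractibleFibre.WeakCouplingContinuumLeg ↔ ConvexGribovBody.ContinuumLegGivenGap) :=
  ⟨Iff.rfl, Iff.rfl, Iff.rfl⟩

/-- **Read-back (definitional)**: the crux is `∀ G` compact simple (Borel σ-algebra), `GapHyp G → Concl G`.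
[folklore] -/
theorem crux_iff :
    ConvexGribovBody.ContinuumLegGivenGap ↔
      ∀ (G : Type) [Group G] [TopologicalSpace G] [IsTopologicalGroup G] [CompactSpace G],
        IsCompactSimpleLieGroup G →
          letI : MeasurableSpace G := borel G
          haveI : BorelSpace G := ⟨rfl⟩
          (∀ r : LatticeRep G, GapHypAt G r) → Concl G :=
  Iff.rfl

/-- `YangMills` is literally `∀ G, Concl G`. [folklore] -/
theorem yangMills_iff :
    YangMills ↔
      ∀ (G : Type) [Group G] [TopologicalSpace G] [IsTopologicalGroup G] [CompactSpace G],
        IsCompactSimpleLieGroup G →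
          letI : MeasurableSpace G := borel G
          haveI : BorelSpace G := ⟨rfl⟩
          Concl G :=
  Iff.rfl

/-- **The crux is one hypothesis weaker than the summit conjunct** (landed dock, by name). [folklore] -/
theorem crux_of_yangMills (h : YangMills) : ConvexGribovBody.ContinuumLegGivenGap :=
  ContinuumLegGivenGap.continuumLegGivenGap_of_yangMills h

/-- **Where the lattice gap fails the crux is free**: at a `G` with `¬ GapHyp G` the implication holds vacuously.
[folklore] -/
theorem cruxAt_of_not_gapHyp {G : Type} [Group G] [TopologicalSpace G] [IsTopologicalGroup G]
    [CompactSpace G] [MeasurableSpace G] [BorelSpace G]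
    (h : ¬ ∀ r : LatticeRep G, GapHypAt G r) : (∀ r : LatticeRep G, GapHypAt G r) → Concl G :=
  fun h' => (h h').elim

/-- **The disproof burden, exactly**: `¬ crux ↔` SOME compact simple `G` has the volume-uniform weak-coupling
lattice gap in EVERY faithful `r` AND no Clay witness (re-typed shape). [folklore] -/
theorem not_crux_iff :
    ¬ ConvexGribovBody.ContinuumLegGivenGap ↔
      ∃ (G : Type) (_ : Group G) (_ : TopologicalSpace G) (_ : IsTopologicalGroup G) (_ : CompactSpace G),
        IsCompactSimpleLieGroup G ∧
          letI : MeasurableSpace G := borel G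
          haveI : BorelSpace G := ⟨rfl⟩
          (∀ r : LatticeRep G, GapHypAt G r) ∧ ¬ Concl G := by
  constructor
  · intro h
    by_contra hne
    refine h fun G _ _ _ _ hG hgap => ?_
    by_contra hc
    exact hne ⟨G, _, _, _, _, hG, hgap, hc⟩
  · rintro ⟨G, _, _, _, _, hG, hgap, hc⟩ h
    exact hc (h G hG hgap)

/-- A refutation of the crux PROVES the lattice IR gap for some compact simple `G`, all `r`. [folklore] -/
theorem gapHyp_of_not_crux (h : ¬ ConvexGribovBody.ContinuumLegGivenGap) :
    ∃ (G : Type) (_ : Group G) (_ : TopologicalSpace G) (_ : IsTopologicalGroup G) (_ : CompactSpace G),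
      IsCompactSimpleLieGroup G ∧
        letI : MeasurableSpace G := borel G
        haveI : BorelSpace G := ⟨rfl⟩
        ∀ r : LatticeRep G, GapHypAt G r := by
  obtain ⟨G, _, _, _, _, hG, hgap, -⟩ := not_crux_iff.1 h
  exact ⟨G, _, _, _, _, hG, hgap⟩

/-- A refutation of the crux REFUTES the summit conjunct `YangMills` as typed. [folklore] -/
theorem not_yangMills_of_not_crux (h : ¬ ConvexGribovBody.ContinuumLegGivenGap) : ¬ YangMills :=
  fun hYM => h (crux_of_yangMills hYM)

/-- **Dominance `15828 ⇒ 9443`** (tree, by name): the crux implies `ClusteringToYangMills`. [folklore] -/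
theorem clusteringToYangMills_of_crux (h : ConvexGribovBody.ContinuumLegGivenGap) :
    FradkinShenkerFlow.ClusteringToYangMills :=
  ClusteringToYangMills.ClusteringToYangMills_of_continuumLegGivenGap h

/-- Contraposed: a refutation of 9443 refutes this crux. [folklore] -/
theorem not_crux_of_not_clusteringToYangMills (h : ¬ FradkinShenkerFlow.ClusteringToYangMills) :
    ¬ ConvexGribovBody.ContinuumLegGivenGap :=
  fun hc => h (clusteringToYangMills_of_crux hc)

/-- **Dominance `15828 ⇒ 15940`** (landed dock, by name): the crux implies the re-typed hub
`CriticalContinuumLimit`, which assumes more (β-uniform constants and criticality). [folklore] -/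
theorem criticalContinuumLimit_of_crux (h : ConvexGribovBody.ContinuumLegGivenGap) :
    EquipartitionCriticality.CriticalContinuumLimit :=
  ContinuumLegGivenGap.criticalContinuumLimit_of_continuumLegGivenGap h

/-- **Under the route's own target the crux IS the summit conjunct**: `UniformLatticeGap` (stmt-8778) discharges
`GapHyp G` for every compact simple `G`, so `crux ↔ YangMills`. [folklore] -/
theorem crux_iff_yangMills_of_uniformLatticeGap (hU : ConvexGribovBody.UniformLatticeGap) :
    ConvexGribovBody.ContinuumLegGivenGap ↔ YangMills := by
  refine ⟨fun h G _ _ _ _ hG => ?_, crux_of_yangMills⟩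
  letI : MeasurableSpace G := borel G
  haveI : BorelSpace G := ⟨rfl⟩
  exact h G hG fun r => hU G hG r

/-- The same with the route's rev-5 cut along `π₁(G)`: `NonSimplyConnectedLatticeGap` plus the simply-connected
case of the target give `crux ↔ YangMills`; so on this route the crux is target-sized. [folklore] -/
theorem crux_iff_yangMills_of_cut
    (hSC : ∀ (G : Type) [Group G] [TopologicalSpace G] [IsTopologicalGroup G] [CompactSpace G]
      [MeasurableSpace G] [BorelSpace G], IsCompactSimpleLieGroup G → SimplyConnectedSpace G →
      ∀ r : LatticeRep G, GapHypAt G r)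
    (hNSC : ConvexGribovBody.NonSimplyConnectedLatticeGap) :
    ConvexGribovBody.ContinuumLegGivenGap ↔ YangMills := by
  refine ⟨fun h G _ _ _ _ hG => ?_, crux_of_yangMills⟩
  letI : MeasurableSpace G := borel G
  haveI : BorelSpace G := ⟨rfl⟩
  refine h G hG fun r => ?_
  by_cases hsc : SimplyConnectedSpace G
  · exact hSC G hG hsc r
  · exact hNSC G hG hsc r

end Anatomy


/-! ## §1 The hypothesis `GapHyp`: thresholds are cosmetic; which clauses carry content (UNCHANGED by the re-type) -/

section Hypothesis

variable {G : Type} [Group G] [TopologicalSpace G] [IsTopologicalGroup G] [CompactSpace G]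
  [MeasurableSpace G] [BorelSpace G]

/-- **`GapHypAt` is 9443's per-coupling hypothesis with a tail** (landed `gapHyp_iff_torusClusteringAt`): the
volume threshold `S₁(β)` is COSMETIC (a priori bound `|corr| ≤ 2‖A‖∞‖B‖∞` on the finitely many tori below it).
[folklore] -/
theorem gapHypAt_iff_ec (r : LatticeRep G) :
    GapHypAt G r ↔ ∃ β₀ : ℝ, ∀ β : ℝ, β₀ ≤ β → EC G r β :=
  ContinuumLegGivenGap.gapHyp_iff_torusClusteringAt r

/-- **Per-volume clustering is contentless**: on EACH torus separately a constant exists for every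
`G, r, β, m, A, B` (a priori bound).  With `∀ S ∃ C` in place of `∃ C ∀ S` the hypothesis says nothing. [folklore] -/
theorem ec_perVolume (r : LatticeRep G) (β m : ℝ) (A B : YMSpecies G) (S : ℕ) :
    ∃ C : ℝ, ∀ n : ℕ, n ≤ S →
      |latticeConnectedCorr r.ρ β (2 * S + 1) A.F B.F n| ≤ C * Real.exp (-(m * n)) := by
  obtain ⟨CA, hCA⟩ := A.bounded
  obtain ⟨CB, hCB⟩ := B.bounded
  refine ⟨2 * (CA * CB) * Real.exp (|m| * S), fun n hn => ?_⟩
  have h := abs_latticeConnectedCorr_le r β (2 * S + 1) hCA hCB n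
  have hCAB : 0 ≤ 2 * (CA * CB) := le_trans (abs_nonneg _) h
  have hexp : 1 ≤ Real.exp (|m| * S) * Real.exp (-(m * n)) := by
    rw [← Real.exp_add, Real.one_le_exp_iff]
    have hnS : (n : ℝ) ≤ S := by exact_mod_cast hn
    have hn0 : (0 : ℝ) ≤ n := Nat.cast_nonneg _
    have h1 : m * n ≤ |m| * n := mul_le_mul_of_nonneg_right (le_abs_self m) hn0
    have h2 : |m| * n ≤ |m| * S := mul_le_mul_of_nonneg_left hnS (abs_nonneg m)
    linarith
  calc |latticeConnectedCorr r.ρ β (2 * S + 1) A.F B.F n| ≤ 2 * (CA * CB) * 1 := by rw [mul_one]; exact h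
    _ ≤ 2 * (CA * CB) * (Real.exp (|m| * S) * Real.exp (-(m * n))) := mul_le_mul_of_nonneg_left hexp hCAB
    _ = 2 * (CA * CB) * Real.exp (|m| * S) * Real.exp (-(m * n)) := by ring

omit [MeasurableSpace G] [BorelSpace G] in
/-- **… so the per-volume variant of the crux is literally `YangMills`.** [folklore] -/
theorem cruxPerVolume_iff_yangMills :
    (∀ (G : Type) [Group G] [TopologicalSpace G] [IsTopologicalGroup G] [CompactSpace G],
        IsCompactSimpleLieGroup G →
          letI : MeasurableSpace G := borel G
          haveI : BorelSpace G := ⟨rfl⟩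
          (∀ r : LatticeRep G, ∃ β₀ : ℝ, ∀ β : ℝ, β₀ ≤ β → ∃ m : ℝ, 0 < m ∧ ∃ S₁ : ℕ,
            ∀ A B : YMSpecies G, ∀ S : ℕ, ∃ C : ℝ, ∀ n : ℕ, S₁ ≤ S → n ≤ S →
              |latticeConnectedCorr r.ρ β (2 * S + 1) A.F B.F n| ≤ C * Real.exp (-(m * n))) →
          Concl G) ↔ YangMills := by
  refine ⟨fun h G _ _ _ _ hG => ?_, fun h G _ _ _ _ hG _ => h G hG⟩
  letI : MeasurableSpace G := borel G
  haveI : BorelSpace G := ⟨rfl⟩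
  refine h G hG fun r => ⟨0, fun β _ => ⟨1, one_pos, 0, fun A B S => ?_⟩⟩
  exact (ec_perVolume r β 1 A B S).imp fun C hC n _ hn => hC n hn

/-- **Dropping the thermal clause `n ≤ S` (keeping any threshold) makes the hypothesis FALSE** for every
non-abelian compact `G`, faithful `r`, every `β`, rate and threshold (periodicity `corr(k(2S+1)) = corr(0) = Var > 0`
of the curvature autocorrelation on the threshold torus; landed `not_hasLatticeMassGapAllTimes` machinery,
here through its torus-level core `latticeConnectedCorr_add_mul_side` + `variance_pos`). [folklore] -/
theorem not_ecAllTimes_threshold (hG : ∃ a b : G, a * b ≠ b * a) (r : LatticeRep G) (β : ℝ) {m : ℝ}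
    (hm : 0 < m) (S₁ : ℕ) :
    ¬ ∃ C : ℝ, ∀ S n : ℕ, S₁ ≤ S →
      |latticeConnectedCorr r.ρ β (2 * S + 1) r.curvature.F r.curvature.F n| ≤
        C * Real.exp (-(m * n)) := by
  rintro ⟨C, hC⟩
  obtain ⟨a, b, hab⟩ := hG
  set S := S₁
  have hbound : ∀ k : ℕ, |latticeConnectedCorr r.ρ β (2 * S + 1) r.curvature.F r.curvature.F 0| ≤
      C * Real.exp (-(m * ((0 + k * (2 * S + 1) : ℕ) : ℝ))) := fun k => by
    rw [← latticeConnectedCorr_add_mul_side r.ρ β (2 * S + 1) r.curvature.F r.curvature.F 0 k]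
    exact hC S _ le_rfl
  have hlim : Tendsto (fun k : ℕ => C * Real.exp (-(m * ((0 + k * (2 * S + 1) : ℕ) : ℝ)))) atTop (𝓝 0) := by
    have h1 : Tendsto (fun k : ℕ => m * ((0 + k * (2 * S + 1) : ℕ) : ℝ)) atTop atTop := by
      have : (fun k : ℕ => m * ((0 + k * (2 * S + 1) : ℕ) : ℝ)) =
          fun k : ℕ => (m * ((2 * S + 1 : ℕ) : ℝ)) * (k : ℝ) := by
        funext k; push_cast; ring
      rw [this]
      exact Tendsto.const_mul_atTop (mul_pos hm (by positivity)) tendsto_natCast_atTop_atTop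
    have h2 := Real.tendsto_exp_atBot.comp (tendsto_neg_atTop_atBot.comp h1)
    simpa using h2.const_mul C
  have h0 : |latticeConnectedCorr r.ρ β (2 * S + 1) r.curvature.F r.curvature.F 0| ≤ 0 :=
    ge_of_tendsto' hlim hbound
  have hz : latticeConnectedCorr r.ρ β (2 * S + 1) r.curvature.F r.curvature.F 0 = 0 :=
    abs_eq_zero.1 (le_antisymm h0 (abs_nonneg _))
  rw [latticeConnectedCorr_zero_time] at hz
  have hP : Continuous fun W : GaugeConfig 4 (2 * S + 1) G => r.curvature.F (torusLift (2 * S + 1) W) :=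
    (continuous_actionDensity r.continuous).comp (continuous_pi fun _ => continuous_apply _)
  have hne : r.curvature.F (torusLift (2 * S + 1)
      (fun e : Edge 4 (2 * S + 1) => if e.2 = 0 then a else if e.2 = 1 then b else (1 : G))) ≠
      r.curvature.F (torusLift (2 * S + 1) (fun _ => 1)) := by
    rw [torusLift_dirConfigT, torusLift_one]
    exact actionDensity_ne r hab
  exact (variance_pos r β (2 * S + 1) hP hne).ne' hz

omit [MeasurableSpace G] [BorelSpace G] in
/-- **… so the all-times variant of the crux is VACUOUSLY true** (its hypothesis fails at the curvature pair for
every compact simple `G`). [folklore] -/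
theorem cruxAllTimes_trivial :
    ∀ (G : Type) [Group G] [TopologicalSpace G] [IsTopologicalGroup G] [CompactSpace G],
      IsCompactSimpleLieGroup G →
        letI : MeasurableSpace G := borel G
        haveI : BorelSpace G := ⟨rfl⟩
        (∀ r : LatticeRep G, ∃ β₀ : ℝ, ∀ β : ℝ, β₀ ≤ β → ∃ m : ℝ, 0 < m ∧ ∃ S₁ : ℕ,
          ∀ A B : YMSpecies G, ∃ C : ℝ, ∀ S n : ℕ, S₁ ≤ S →
            |latticeConnectedCorr r.ρ β (2 * S + 1) A.F B.F n| ≤ C * Real.exp (-(m * n))) →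
        Concl G := by
  intro G _ _ _ _ hG
  letI : MeasurableSpace G := borel G
  haveI : BorelSpace G := ⟨rfl⟩
  intro h
  exfalso
  obtain ⟨r⟩ := hG.2
  obtain ⟨β₀, hβ₀⟩ := h r
  obtain ⟨m, hm, S₁, hAB⟩ := hβ₀ β₀ le_rfl
  exact not_ecAllTimes_threshold hG.1.2.1 r β₀ hm S₁ (hAB r.curvature r.curvature)

/-- **For a one-element gauge group every connected torus correlation vanishes** (all observables are
deterministic under the — probability — Wilson measure). [folklore] -/
theorem latticeConnectedCorr_subsingleton [Subsingleton G] (r : LatticeRep G) (β : ℝ) (S : ℕ) [NeZero S]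
    (A B : LGConfig 4 G → ℝ) (n : ℕ) : latticeConnectedCorr r.ρ β S A B n = 0 := by
  haveI := isProbabilityMeasure_wilsonMeasure (d := 4) (L := S) r.ρ r.continuous β
  have hconst : ∀ (h : GaugeConfig 4 S G → ℝ) (U₀ : GaugeConfig 4 S G),
      ∫ U, h U ∂(wilsonMeasure (d := 4) (L := S) r.ρ β) = h U₀ := by
    intro h U₀
    have hc : (fun U => h U) = fun _ => h U₀ := funext fun U => congrArg h (Subsingleton.elim U U₀)
    rw [hc, integral_const, smul_eq_mul, probReal_univ, one_mul]
  set U₀ : GaugeConfig 4 S G := fun _ => 1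
  unfold latticeConnectedCorr
  rw [hconst (fun U => A (torusLift S U) * B (configShift (-Pi.single 0 (n : ℤ)) (torusLift S U))) U₀,
    hconst (fun U => A (torusLift S U)) U₀, hconst (fun U => B (torusLift S U)) U₀]
  have hB : B (configShift (-Pi.single 0 (n : ℤ)) (torusLift S U₀)) = B (torusLift S U₀) :=
    congrArg B (Subsingleton.elim _ _)
  rw [hB, sub_self]

/-- **The trivial group satisfies the crux's hypothesis** (rate `1`, threshold `0`, constant `0`). [folklore] -/
theorem gapHypAt_of_subsingleton [Subsingleton G] (r : LatticeRep G) : GapHypAt G r :=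
  ⟨0, fun β _ => ⟨1, one_pos, 0, fun A B => ⟨0, fun S n _ _ => by
    rw [latticeConnectedCorr_subsingleton r β (2 * S + 1) A.F B.F n, abs_zero, zero_mul]⟩⟩⟩

end Hypothesis

/-! ## §2 The conclusion `Concl` modulo junk — RE-TYPE DELTA: `HasWeakCouplingLimit` kills the free witness;
`ConclMinus` now CONSUMES `GapHyp`; non-abelianness and linearity stay load-bearing -/

section Conclusion

variable {G : Type} [Group G] [TopologicalSpace G] [IsTopologicalGroup G] [CompactSpace G]
  [MeasurableSpace G] [BorelSpace G]

/-- **The WEAK vacuum scheme**: `a_k = 1/(k+1)`, `β_k = k → ∞`, `L_k = (k+1)²`, `c ≡ m ≡ 0`. [folklore] -/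
def weakVacuumScheme (ι : Type) : SpeciesScheme ι where
  a := fun k => ((k : ℝ) + 1)⁻¹
  a_pos := fun k => by positivity
  tendsto_a := tendsto_inv_atTop_zero.comp (tendsto_natCast_atTop_atTop.atTop_add tendsto_const_nhds)
  β := fun k => k
  L := fun k => (k + 1) ^ 2
  tendsto_L := by
    have h : (fun k : ℕ => ((k : ℝ) + 1)⁻¹ * (((k + 1) ^ 2 : ℕ) : ℝ)) = fun k : ℕ => (k : ℝ) + 1 := by
      funext k; push_cast; field_simp
    rw [h]
    exact tendsto_natCast_atTop_atTop.atTop_add tendsto_const_nhds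
  c := fun _ _ => 0
  m := fun _ _ => 0

omit [TopologicalSpace G] [IsTopologicalGroup G] [CompactSpace G] [BorelSpace G] in
/-- Any scheme with `c ≡ 0` ties the VACUUM OS datum to the lattice (`IsYangMillsFor`): every lattice `n`-point
function, `n ≥ 1`, is a product with a zero factor. [folklore] -/
theorem isYangMillsFor_vacuum_of_c_zero [TopologicalSpace G] [IsTopologicalGroup G] [CompactSpace G]
    [BorelSpace G] (r : LatticeRep G) (sch : SpeciesScheme (YMSpecies G)) (hc : ∀ s k, sch.c s k = 0) :
    IsYangMillsFor r sch (OSData.vacuum (YMSpecies G) 4) := by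
  intro n hn σ f F _ _
  have hS : (OSData.vacuum (YMSpecies G) 4).schwinger n σ F = 0 := by
    simp [OSData.vacuum, LabelledSchwingerFamily.trivial_of_ne_zero (YMSpecies G) hn]
  rw [hS]
  refine tendsto_const_nhds.congr' (Eventually.of_forall fun k => ?_)
  show (0 : ℂ) = ((latticeSchwinger r.ρ sch (fun s => s.F) k n σ f : ℝ) : ℂ)
  obtain ⟨j, rfl⟩ := Nat.exists_eq_succ_of_ne_zero hn
  simp [latticeSchwinger, smearedLatticeField, hc]

/-- **`HasWeakCouplingLimit` ALONE IS NOT LOAD-BEARING against the vacuum witness.**  For every `G` and `r` the weak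
vacuum scheme (`β_k = k → ∞`, `c ≡ 0`) with the vacuum OS datum satisfies the weak-coupling clause, `IsYangMillsFor`
and EVERY continuum mass gap — and is neither non-trivial nor non-Gaussian.  So the new clause does not by itself
shift any burden onto the interacting clauses; what it changes is the LATTICE clause (next lemmas). [folklore] -/
theorem hwc_vacuum_witness (r : LatticeRep G) :
    (weakVacuumScheme (YMSpecies G)).HasWeakCouplingLimit ∧
      IsYangMillsFor r (weakVacuumScheme (YMSpecies G)) (OSData.vacuum (YMSpecies G) 4) ∧
      (∀ Δ : ℝ, (OSData.vacuum (YMSpecies G) 4).HasMassGap Δ) ∧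
      ¬ (OSData.vacuum (YMSpecies G) 4).IsNontrivial r.curvature ∧
      ¬ (OSData.vacuum (YMSpecies G) 4).IsNonGaussian r.curvature :=
  ⟨tendsto_natCast_atTop_atTop, isYangMillsFor_vacuum_of_c_zero r _ fun _ _ => rfl,
    OSData.vacuum_hasMassGap, OSData.not_isNontrivial_vacuum _, OSData.not_isNonGaussian_vacuum _⟩

omit [TopologicalSpace G] [IsTopologicalGroup G] [CompactSpace G] [BorelSpace G] in
/-- **The gen-1 free witness is DEAD**: the zero scheme (`β ≡ 0`, which carried `HasLatticeMassGap` for free by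
independence of Haar links) violates the new clause (tree `not_hasWeakCouplingLimit_zero`); more generally no
scheme with bounded couplings qualifies. [folklore] -/
theorem boundedCoupling_dead (sch : SpeciesScheme (YMSpecies G)) {B : ℝ} (hB : ∀ k, sch.β k ≤ B) :
    ¬ sch.HasWeakCouplingLimit :=
  SpeciesScheme.not_hasWeakCouplingLimit_of_le sch hB

/-- **What `ConclMinus` says about the lattice** (read-back, both directions elementary): a witness of the
conclusion-minus-non-triviality at `(G, r)` is EXACTLY a sequential weak-coupling volume-uniform lattice gap in
physical units (`SeqLatticeGap`): `→` forget `T` and the renormalisations; `←` take `c ≡ m ≡ 0` and the vacuum OS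
datum (every continuum gap, `IsYangMillsFor` by `isYangMillsFor_vacuum_of_c_zero`). [folklore] -/
theorem conclMinus_iff_seqLatticeGap (r : LatticeRep G) : ConclMinus G r ↔ SeqLatticeGap G r := by
  constructor
  · rintro ⟨sch, T, hw, -, Δ, hΔ, -, hL⟩
    exact ⟨sch.a, sch.β, sch.L, sch.a_pos, sch.tendsto_a, sch.tendsto_L, hw, Δ, hΔ, hL⟩
  · rintro ⟨a, β, L, ha, ha0, haL, hβ, Δ, hΔ, hL⟩
    let sch : SpeciesScheme (YMSpecies G) :=
      { a := a, a_pos := ha, tendsto_a := ha0, β := β, L := L, tendsto_L := haL,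
        c := fun _ _ => 0, m := fun _ _ => 0 }
    exact ⟨sch, OSData.vacuum _ 4, hβ, isYangMillsFor_vacuum_of_c_zero r sch fun _ _ => rfl, Δ, hΔ,
      OSData.vacuum_hasMassGap Δ, hL⟩

/-- **THE RE-TYPE MAKES `GapHyp` CONSUMABLE (softly): `GapHypAt G r → SeqLatticeGap G r`.**  Torus clustering
above `β₀` (threshold absorbed) ⇒ along `β_k := max β₀ 0 + k → ∞` the landed `stub_alongSequence` gives k-UNIFORM
per-pair constants at (sacrificed) rates `m_k > 0`; put `a_k := min (1/(k+1)) (m_k)` (so `Δ := 1` has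
`Δ a_k ≤ m_k`), `L_k := ⌈(k+1)/a_k⌉₊` (so `a_k L_k ≥ k+1 → ∞`). Pure bookkeeping over landed lemmas — the rate
sacrifice is absorbed by the FREE choice of the spacings `a_k`, i.e. by giving up any relation between `a_k` and the
physical correlation length.  This is exactly the freedom the interacting clauses will take away (§4). [folklore] -/
theorem seqLatticeGap_of_gapHypAt (r : LatticeRep G) (h : GapHypAt G r) : SeqLatticeGap G r := by
  obtain ⟨β₀, hβ₀⟩ := (gapHypAt_iff_ec r).1 h
  obtain ⟨m, hm, hC⟩ := ContinuumLegGivenGap.stub_alongSequence G r (fun k : ℕ => max β₀ 0 + k)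
    fun k => hβ₀ _ ((le_max_left β₀ 0).trans (le_add_of_nonneg_right (Nat.cast_nonneg k)))
  -- spacings and half-sides
  set a : ℕ → ℝ := fun k => min (((k : ℝ) + 1)⁻¹) (m k) with ha_def
  have ha_pos : ∀ k, 0 < a k := fun k => lt_min (by positivity) (hm k)
  have ha_le_inv : ∀ k, a k ≤ ((k : ℝ) + 1)⁻¹ := fun k => min_le_left _ _
  have ha_le_m : ∀ k, a k ≤ m k := fun k => min_le_right _ _
  have ha0 : Tendsto a atTop (𝓝 0) := by
    have hinv : Tendsto (fun k : ℕ => ((k : ℝ) + 1)⁻¹) atTop (𝓝 0) :=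
      tendsto_inv_atTop_zero.comp (tendsto_natCast_atTop_atTop.atTop_add tendsto_const_nhds)
    exact tendsto_of_tendsto_of_tendsto_of_le_of_le tendsto_const_nhds hinv (fun k => (ha_pos k).le) ha_le_inv
  set L : ℕ → ℕ := fun k => ⌈((k : ℝ) + 1) / a k⌉₊ with hL_def
  have hk1 : Tendsto (fun k : ℕ => (k : ℝ) + 1) atTop atTop :=
    tendsto_natCast_atTop_atTop.atTop_add tendsto_const_nhds
  have haL : Tendsto (fun k => a k * L k) atTop atTop := by
    refine tendsto_atTop_mono (fun k => ?_) hk1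
    have hk : ((k : ℝ) + 1) = a k * (((k : ℝ) + 1) / a k) := by field_simp [(ha_pos k).ne']
    calc (k : ℝ) + 1 = a k * (((k : ℝ) + 1) / a k) := hk
      _ ≤ a k * (L k : ℝ) := mul_le_mul_of_nonneg_left (Nat.le_ceil _) (ha_pos k).le
  refine ⟨a, fun k => max β₀ 0 + k, L, ha_pos, ha0, haL,
    tendsto_atTop_add_const_left atTop (max β₀ 0) tendsto_natCast_atTop_atTop, 1, one_pos, fun A B => ?_⟩
  obtain ⟨C, hCAB⟩ := hC A B
  refine ⟨max C 0, Eventually.of_forall fun k S _ n hn => (hCAB k S n hn).trans ?_⟩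
  have hexp : Real.exp (-(m k * n)) ≤ Real.exp (-(1 * (a k * n))) := by
    refine Real.exp_le_exp.2 (neg_le_neg ?_)
    rw [one_mul]
    exact mul_le_mul_of_nonneg_right (ha_le_m k) (Nat.cast_nonneg n)
  calc C * Real.exp (-(m k * n)) ≤ max C 0 * Real.exp (-(m k * n)) :=
        mul_le_mul_of_nonneg_right (le_max_left _ _) (Real.exp_pos _).le
    _ ≤ max C 0 * Real.exp (-(1 * (a k * n))) := mul_le_mul_of_nonneg_left hexp (le_max_right _ _)

/-- **`ConclMinus` from `GapHypAt`** (corollary). [folklore] -/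
theorem conclMinus_of_gapHypAt (r : LatticeRep G) (h : GapHypAt G r) : ConclMinus G r :=
  (conclMinus_iff_seqLatticeGap r).2 (seqLatticeGap_of_gapHypAt r h)

omit [Group G] [TopologicalSpace G] [IsTopologicalGroup G] [CompactSpace G] [MeasurableSpace G]
  [BorelSpace G] in
/-- **The crux with `IsNontrivial ∧ IsNonGaussian` deleted is a THEOREM — but, unlike gen 1 (zero scheme,
hypothesis decoration), its proof now USES the hypothesis** (at the one faithful `r` that `IsCompactSimpleLieGroup`
supplies).  ALL remaining difficulty sits in the two interacting clauses at `β_k → ∞`. [folklore] -/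
theorem cruxMinusNontriviality_holds :
    ∀ (G : Type) [Group G] [TopologicalSpace G] [IsTopologicalGroup G] [CompactSpace G],
      IsCompactSimpleLieGroup G →
        letI : MeasurableSpace G := borel G
        haveI : BorelSpace G := ⟨rfl⟩
        (∀ r : LatticeRep G, GapHypAt G r) → ∃ r : LatticeRep G, ConclMinus G r := by
  intro G _ _ _ _ hG
  letI : MeasurableSpace G := borel G
  haveI : BorelSpace G := ⟨rfl⟩
  intro h
  obtain ⟨r⟩ := hG.2
  exact ⟨r, conclMinus_of_gapHypAt r (h r)⟩

/-- **Conversely the hypothesis-free `ConclMinus` is a genuine lattice statement now**: `(∃ r, ConclMinus G r)` is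
`(∃ r, SeqLatticeGap G r)` — clustering of ALL pairs of local observables at couplings `β_k → ∞` with constants
uniform in `k` and in the volume.  Gen 1's `cruxWithoutNontriviality_trivial` (no hypothesis used) does not survive
the re-type: its witness had `β ≡ 0` (`boundedCoupling_dead`). [folklore] -/
theorem exists_conclMinus_iff_exists_seqLatticeGap :
    (∃ r : LatticeRep G, ConclMinus G r) ↔ ∃ r : LatticeRep G, SeqLatticeGap G r :=
  exists_congr fun r => conclMinus_iff_seqLatticeGap r

/-- **Every witness of `Concl G` is a witness of `ConclMinus`, hence of `SeqLatticeGap`** (the lattice shadow of a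
Clay witness). [folklore] -/
theorem seqLatticeGap_of_concl (h : Concl G) : ∃ r : LatticeRep G, SeqLatticeGap G r := by
  obtain ⟨r, sch, T, hw, hYM, -, -, Δ, hΔ, hgap, hL⟩ := h
  exact ⟨r, (conclMinus_iff_seqLatticeGap r).1 ⟨sch, T, hw, hYM, Δ, hΔ, hgap, hL⟩⟩

/-- **`Concl` fails for a one-element gauge group** (compact, connected, linear — everything in
`IsCompactSimpleLieGroup` but non-abelianness): every lattice `n`-point function is a product of one-point
functions, so `IsYangMillsFor` forces the curvature two-point function to factorise on real off-diagonal tensors and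
the real→complex bridge kills `IsNontrivial` — for EVERY scheme (weak-coupling or not), i.e. no renormalisations
`c_k, m_k` fake non-triviality (landed `not_converges_and_twoPointNontrivial_of_subsingleton`). [folklore] -/
theorem not_concl_of_subsingleton [Subsingleton G] : ¬ Concl G := by
  rintro ⟨r, sch, T, -, hYM, hnt, -, -⟩
  exact not_converges_and_twoPointNontrivial_of_subsingleton r sch T.schwinger hYM hnt

omit [Group G] [TopologicalSpace G] [IsTopologicalGroup G] [CompactSpace G] [MeasurableSpace G]
  [BorelSpace G] in
/-- **NON-ABELIANNESS IS LOAD-BEARING (re-typed shape): the crux with `IsCompactSimpleLieGroup G` weakened to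
"connected and linear" is FALSE.**  Witness `G = PUnit`: `GapHyp` holds (`gapHypAt_of_subsingleton`) and `Concl`
fails (`not_concl_of_subsingleton`). [folklore] -/
theorem crux_false_without_nonabelian :
    ¬ (∀ (G : Type) [Group G] [TopologicalSpace G] [IsTopologicalGroup G] [CompactSpace G],
        ConnectedSpace G → Nonempty (LatticeRep G) →
          letI : MeasurableSpace G := borel G
          haveI : BorelSpace G := ⟨rfl⟩
          (∀ r : LatticeRep G, GapHypAt G r) → Concl G) := by
  intro h
  letI : MeasurableSpace PUnit := borel PUnit
  haveI : BorelSpace PUnit := ⟨rfl⟩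
  exact not_concl_of_subsingleton (h PUnit inferInstance ⟨punitRep⟩ fun r => gapHypAt_of_subsingleton r)

omit [Group G] [TopologicalSpace G] [IsTopologicalGroup G] [CompactSpace G] [MeasurableSpace G]
  [BorelSpace G] in
/-- **LINEARITY IS LOAD-BEARING (re-typed shape): the crux with `IsCompactSimpleLieGroup G` weakened to
`IsSimpleCompactGroup G` is FALSE.**  Witness: `D₃` with the indiscrete topology — `GapHyp` holds VACUOUSLY (no
lattice representation at all, landed `isEmpty_latticeRep_indiscrete`) while `Concl` needs one. [folklore] -/
theorem crux_false_without_linear :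
    ¬ (∀ (G : Type) [Group G] [TopologicalSpace G] [IsTopologicalGroup G] [CompactSpace G],
        IsSimpleCompactGroup G →
          letI : MeasurableSpace G := borel G
          haveI : BorelSpace G := ⟨rfl⟩
          (∀ r : LatticeRep G, GapHypAt G r) → Concl G) := by
  intro h
  letI : TopologicalSpace (DihedralGroup 3) := ⊤
  haveI : IsTopologicalGroup (DihedralGroup 3) :=
    { continuous_mul := continuous_top, continuous_inv := continuous_top }
  letI : MeasurableSpace (DihedralGroup 3) := borel _
  haveI : BorelSpace (DihedralGroup 3) := ⟨rfl⟩
  have hna : ∃ a b : DihedralGroup 3, a * b ≠ b * a :=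
    ⟨DihedralGroup.r 1, DihedralGroup.sr 0, by decide⟩
  have hE := ContinuumLegGivenGap.Negative.isEmpty_latticeRep_indiscrete (DihedralGroup 3)
  obtain ⟨r, -⟩ := h (DihedralGroup 3)
    (Summit.QuantumFields.QCD.Theorems.YangMills.Negative.isSimpleCompactGroup_indiscrete _ hna)
    (fun r => (hE.false r).elim)
  exact hE.false r

end Conclusion


section SequentialMutation

variable {G : Type} [Group G] [TopologicalSpace G] [IsTopologicalGroup G] [CompactSpace G]
  [MeasurableSpace G] [BorelSpace G]

/-- **HYPOTHESIS MUTATION: the tail `∀ β ≥ β₀` is stronger than the soft part needs.**  `SeqLatticeGap` already follows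
from torus clustering along ANY sequence of couplings `β_j → +∞` (per-index rate, per-index per-pair constants) — the
landed `stub_alongSequence` never uses that the clustering couplings fill a tail.  So for everything but the
interacting clauses the crux's hypothesis could be weakened to "GapHyp along some sequence `β_j → ∞`"; whether the FULL
tail matters for `IsNontrivial ∧ IsNonGaussian` is exactly the criticality question (liminf versus lim of `ξ(β)`,
gen 1 `arvSeq_of_arv`). [folklore] -/
theorem seqLatticeGap_of_seqGapHyp (r : LatticeRep G) {βs : ℕ → ℝ} (hβs : Tendsto βs atTop atTop)
    (h : ∀ j : ℕ, EC G r (βs j)) : SeqLatticeGap G r := by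
  obtain ⟨m, hm, hC⟩ := ContinuumLegGivenGap.stub_alongSequence G r βs h
  set a : ℕ → ℝ := fun k => min (((k : ℝ) + 1)⁻¹) (m k) with ha_def
  have ha_pos : ∀ k, 0 < a k := fun k => lt_min (by positivity) (hm k)
  have ha_le_inv : ∀ k, a k ≤ ((k : ℝ) + 1)⁻¹ := fun k => min_le_left _ _
  have ha_le_m : ∀ k, a k ≤ m k := fun k => min_le_right _ _
  have ha0 : Tendsto a atTop (𝓝 0) := by
    have hinv : Tendsto (fun k : ℕ => ((k : ℝ) + 1)⁻¹) atTop (𝓝 0) :=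
      tendsto_inv_atTop_zero.comp (tendsto_natCast_atTop_atTop.atTop_add tendsto_const_nhds)
    exact tendsto_of_tendsto_of_tendsto_of_le_of_le tendsto_const_nhds hinv (fun k => (ha_pos k).le) ha_le_inv
  set L : ℕ → ℕ := fun k => ⌈((k : ℝ) + 1) / a k⌉₊ with hL_def
  have hk1 : Tendsto (fun k : ℕ => (k : ℝ) + 1) atTop atTop :=
    tendsto_natCast_atTop_atTop.atTop_add tendsto_const_nhds
  have haL : Tendsto (fun k => a k * L k) atTop atTop := by
    refine tendsto_atTop_mono (fun k => ?_) hk1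
    have hk : ((k : ℝ) + 1) = a k * (((k : ℝ) + 1) / a k) := by field_simp [(ha_pos k).ne']
    calc (k : ℝ) + 1 = a k * (((k : ℝ) + 1) / a k) := hk
      _ ≤ a k * (L k : ℝ) := mul_le_mul_of_nonneg_left (Nat.le_ceil _) (ha_pos k).le
  refine ⟨a, βs, L, ha_pos, ha0, haL, hβs, 1, one_pos, fun A B => ?_⟩
  obtain ⟨C, hCAB⟩ := hC A B
  refine ⟨max C 0, Eventually.of_forall fun k S _ n hn => (hCAB k S n hn).trans ?_⟩
  have hexp : Real.exp (-(m k * n)) ≤ Real.exp (-(1 * (a k * n))) := by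
    refine Real.exp_le_exp.2 (neg_le_neg ?_)
    rw [one_mul]
    exact mul_le_mul_of_nonneg_right (ha_le_m k) (Nat.cast_nonneg n)
  calc C * Real.exp (-(m k * n)) ≤ max C 0 * Real.exp (-(m k * n)) :=
        mul_le_mul_of_nonneg_right (le_max_left _ _) (Real.exp_pos _).le
    _ ≤ max C 0 * Real.exp (-(1 * (a k * n))) := mul_le_mul_of_nonneg_left hexp (le_max_right _ _)

/-- … in particular `ConclMinus` from clustering along any `β_j → ∞`. [folklore] -/
theorem conclMinus_of_seqGapHyp (r : LatticeRep G) {βs : ℕ → ℝ} (hβs : Tendsto βs atTop atTop)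
    (h : ∀ j : ℕ, EC G r (βs j)) : ConclMinus G r :=
  (conclMinus_iff_seqLatticeGap r).2 (seqLatticeGap_of_seqGapHyp r hβs h)

end SequentialMutation


/-! ## §3 `-- Targets` / `-- Line Sketch` (reshape 7, PICKED 2026-08-16T18:56Z): the lead's `disprover-wanted: stub_lock`

`stub_lock` (IR, informal from PICKED.md; the typed skeleton is not yet in `Lines/`): along SOME sequence
`β_k → ∞` the per-β torus clustering re-quantises to k-UNIFORM pair constants at a rate `m̂_k` that is SHARP
within a factor `4`.  Question put to the disprover: is this refutable from GapHyp-shaped data plus RP (an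
`abstract_…_false` forcing the factor into the hypotheses), or does RP make it a theorem along a well-chosen
sequence?  ANSWER (two checked lemmas + reading):
* `abstract_lock_false` — WITHOUT positivity the statement is false for every sequence and every factor: a
  GapHyp-shaped family (bounded by `2`, continuous in `β`, clustering at EVERY coupling at the SAME sharp rate `1`
  with per-pair constants, `abstract_lock_sharp`) admits k-uniform constants along NO sequence `β_k → ∞` at ANY
  rates bounded below (`m_k ≥ μ > 0`; a fortiori at rates within a factor `4` of the sharp rate).  The mechanism is
  a PLATEAU of length `j β` before the exponential tail: `log`-CONCAVITY at the kink, which is exactly what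
  reflection positivity forbids (moment sequences are log-convex).  So any proof of `stub_lock` must use RP /
  spectral structure; the a priori bound, continuity in `β` and per-β clustering do not suffice — same verdict as
  gen 1's `abstract_requantise_false` for the `∀β` adapter, now for the sequential, factor-4 form.
* `osNorm_constants` — WITH the transfer-matrix structure the constants are FREE at the EXACT rate: for a
  contraction `‖T‖ ≤ e^{−m}` on (the vacuum-orthogonal part of) an inner-product space,
  `|⟪ψ, Tⁿ φ⟫| ≤ e^{−m n} ‖ψ‖ ‖φ‖` — OS-norm constants, uniform in everything, no factor at all.  Hence no
  RP-compatible abstract family can refute `stub_lock` at the level of infinite-volume OS data either.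
* READING for the lead.  The content of `stub_lock` is therefore neither "requantisation" nor "sharpness" but the
  TORUS side at `n ≤ S`: (i) the thermal trace `Tr(T^{2S+1−n} Â Tⁿ B̂)/Tr T^{2S+1}` versus the matrix element
  (normalisation `Tr T^{S+1}/λ₀^{S+1} → 1` needs `S ≥ S₀(β) ≍ m(β)⁻¹ log(volume)`, a threshold the scheme's free
  `L_k` CAN absorb), (ii) identification of the optimal torus rate with the spectral gap of the `S`-dependent
  transfer matrix, uniformly in `S` (the finite-size core; ideator-1 B2: symmetric-torus local data cannot see
  the thermal multiplicity), (iii) OS norms of FIXED local observables are k-bounded for free (`≤ 2‖A‖∞`).  A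
  refutation of `stub_lock` could only come from (ii) — a thermal multiplicity at scale `m(β_k)` growing along
  EVERY sequence — which GapHyp neither gives nor excludes; I have no model of Wilson's theory doing that.  Verdict:
  not refutable here; not soft; the factor `4` is the prover's slack for (i), not forced by any obstruction I can
  build.
-/

section Targets

/-- The plateau family: pair `j`, coupling `β`, (half-side `S` unused), time `n` ↦ `2·min(1, e^{−(n − j β⁺)})`:
constant `2` up to time `j β⁺`, then the exponential tail at rate `1`. [folklore] -/
def plateau (j : ℕ) (β : ℝ) (n : ℕ) : ℝ :=
  2 * min 1 (Real.exp (-((n : ℝ) - j * max β 0)))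

theorem plateau_nonneg (j : ℕ) (β : ℝ) (n : ℕ) : 0 ≤ plateau j β n :=
  mul_nonneg zero_le_two (le_min zero_le_one (Real.exp_pos _).le)

theorem plateau_le_two (j : ℕ) (β : ℝ) (n : ℕ) : plateau j β n ≤ 2 := by
  have h : min 1 (Real.exp (-((n : ℝ) - j * max β 0))) ≤ 1 := min_le_left _ _
  unfold plateau
  linarith

theorem continuous_plateau (j : ℕ) (n : ℕ) : Continuous fun β : ℝ => plateau j β n := by
  unfold plateau
  fun_prop

/-- On the plateau (`n ≤ j β⁺`) the value is `2`. [folklore] -/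
theorem plateau_eq_two {j : ℕ} {β : ℝ} {n : ℕ} (hn : (n : ℝ) ≤ j * max β 0) : plateau j β n = 2 := by
  unfold plateau
  have h1 : (1 : ℝ) ≤ Real.exp (-((n : ℝ) - j * max β 0)) := by
    rw [Real.one_le_exp_iff]; linarith
  rw [min_eq_left h1, mul_one]

/-- The per-coupling clustering bound: `plateau j β n ≤ 2 e^{j β⁺} · e^{−n}` (rate `1`, per-pair per-β constant).
[folklore] -/
theorem plateau_le_exp (j : ℕ) (β : ℝ) (n : ℕ) :
    plateau j β n ≤ 2 * Real.exp (j * max β 0) * Real.exp (-(1 * (n : ℝ))) := by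
  unfold plateau
  have h : min 1 (Real.exp (-((n : ℝ) - j * max β 0))) ≤ Real.exp (j * max β 0) * Real.exp (-(1 * (n : ℝ))) := by
    refine (min_le_right _ _).trans (le_of_eq ?_)
    rw [← Real.exp_add]; congr 1; ring
  calc 2 * min 1 (Real.exp (-((n : ℝ) - j * max β 0)))
      ≤ 2 * (Real.exp (j * max β 0) * Real.exp (-(1 * (n : ℝ)))) := mul_le_mul_of_nonneg_left h zero_le_two
    _ = 2 * Real.exp (j * max β 0) * Real.exp (-(1 * (n : ℝ))) := by ring

/-- **`stub_lock` IS NOT SOFT (abstract non-lockability without positivity).**  There is a family of "pair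
correlations" `f j β S n`, with `0 ≤ f ≤ 2`, CONTINUOUS in `β`, having the GapHyp/EC shape at EVERY coupling at the
common rate `1` (per-pair, per-β constants), such that along NO sequence of couplings `β_k → +∞` do k-uniform
per-pair constants exist at rates bounded below by any `μ > 0` — in particular not at rates "sharp within a factor
4" (`m_k ∈ [1/4, 1]`, see `abstract_lock_sharp` for sharpness of the rate `1`).  Witness: `plateau`; pair `j = 1`
sits at value `2` up to time `⌊β_k⁺⌋ → ∞`. [folklore] -/
theorem abstract_lock_false :
    ∃ f : ℕ → ℝ → ℕ → ℕ → ℝ, (∀ j β S n, 0 ≤ f j β S n ∧ f j β S n ≤ 2) ∧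
      (∀ j S n, Continuous fun β => f j β S n) ∧
      (∀ β : ℝ, ∀ j : ℕ, ∃ C : ℝ, ∀ S n : ℕ, n ≤ S → f j β S n ≤ C * Real.exp (-(1 * (n : ℝ)))) ∧
      ¬ ∃ βs : ℕ → ℝ, Tendsto βs atTop atTop ∧ ∃ (m : ℕ → ℝ) (μ : ℝ), 0 < μ ∧ (∀ k, μ ≤ m k) ∧
          ∀ j : ℕ, ∃ C : ℝ, ∀ k S n : ℕ, n ≤ S → f j (βs k) S n ≤ C * Real.exp (-(m k * n)) := by
  refine ⟨fun j β _ n => plateau j β n, fun j β _ n => ⟨plateau_nonneg j β n, plateau_le_two j β n⟩,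
    fun j _ n => continuous_plateau j n,
    fun β j => ⟨2 * Real.exp (j * max β 0), fun S n _ => plateau_le_exp j β n⟩, ?_⟩
  rintro ⟨βs, hβs, m, μ, hμ, hμm, hC⟩
  obtain ⟨C, hC1⟩ := hC 1
  -- along the sequence, at pair `j = 1` and time `n_k := ⌊βs k⁺⌋₊ ≤ S := n_k`, the value is `2`
  have hval : ∀ k, (2 : ℝ) ≤ C * Real.exp (-(μ * (⌊max (βs k) 0⌋₊ : ℕ))) := fun k => by
    have hn : ((⌊max (βs k) 0⌋₊ : ℕ) : ℝ) ≤ 1 * max (βs k) 0 := by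
      rw [one_mul]; exact Nat.floor_le (le_max_right _ _)
    have h2 : plateau 1 (βs k) ⌊max (βs k) 0⌋₊ = 2 := plateau_eq_two (by exact_mod_cast hn)
    have hk : plateau 1 (βs k) ⌊max (βs k) 0⌋₊ ≤ C * Real.exp (-(m k * (⌊max (βs k) 0⌋₊ : ℕ))) :=
      hC1 k ⌊max (βs k) 0⌋₊ ⌊max (βs k) 0⌋₊ le_rfl
    rw [h2] at hk
    refine hk.trans ?_
    have hC0 : 0 ≤ C := by
      have := (show (0 : ℝ) < 2 by norm_num).le.trans hk
      exact nonneg_of_mul_nonneg_left this (Real.exp_pos _)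
    refine mul_le_mul_of_nonneg_left (Real.exp_le_exp.2 (neg_le_neg ?_)) hC0
    exact mul_le_mul_of_nonneg_right (hμm k) (Nat.cast_nonneg _)
  -- but `n_k → ∞`, so the right-hand side tends to `0`
  have hfloor : Tendsto (fun k => ((⌊max (βs k) 0⌋₊ : ℕ) : ℝ)) atTop atTop := by
    have h1 : Tendsto (fun k => max (βs k) 0) atTop atTop :=
      tendsto_atTop_mono (fun k => le_max_left _ _) hβs
    have h2 : Tendsto (fun k => ⌊max (βs k) 0⌋₊) atTop atTop := tendsto_nat_floor_atTop.comp h1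
    exact tendsto_natCast_atTop_atTop.comp h2
  have hlim : Tendsto (fun k => C * Real.exp (-(μ * ((⌊max (βs k) 0⌋₊ : ℕ) : ℝ)))) atTop (𝓝 0) := by
    have h3 : Tendsto (fun k => μ * ((⌊max (βs k) 0⌋₊ : ℕ) : ℝ)) atTop atTop :=
      Tendsto.const_mul_atTop hμ hfloor
    have h4 := Real.tendsto_exp_atBot.comp (tendsto_neg_atTop_atBot.comp h3)
    simpa using h4.const_mul C
  have : (2 : ℝ) ≤ 0 := ge_of_tendsto' hlim hval
  linarith

/-- **… and the rate `1` is SHARP at every coupling for every pair `j`** (so rates `m ∈ [1/4, 1]` are exactly the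
"sharp within a factor 4" window of `stub_lock`): no rate `m > 1` admits a constant, because after the plateau the
family IS `2 e^{jβ⁺} e^{−n}`. [folklore] -/
theorem abstract_lock_sharp (j : ℕ) (β : ℝ) {m : ℝ} (hm : 1 < m) :
    ¬ ∃ C : ℝ, ∀ S n : ℕ, n ≤ S → plateau j β n ≤ C * Real.exp (-(m * n)) := by
  rintro ⟨C, hC⟩
  set N : ℝ := j * max β 0 with hN
  -- beyond the plateau: `plateau j β n = 2 e^{N - n}`
  have htail : ∀ n : ℕ, N ≤ n → plateau j β n = 2 * Real.exp (N - n) := fun n hn => by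
    unfold plateau
    have h1 : Real.exp (-((n : ℝ) - j * max β 0)) ≤ 1 := by
      rw [Real.exp_le_one_iff]; rw [hN] at hn; linarith
    rw [min_eq_right h1]; congr 1; congr 1; rw [hN]; ring
  -- so `2 e^{N} e^{(m-1) n} ≤ C` for all large `n`: impossible
  have hbound : ∀ n : ℕ, N ≤ n → 2 * Real.exp N * Real.exp ((m - 1) * n) ≤ C := fun n hn => by
    have h := hC n n le_rfl
    rw [htail n hn] at h
    have hexp : 2 * Real.exp N * Real.exp ((m - 1) * n) =
        2 * Real.exp (N - n) * Real.exp (m * n) := by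
      rw [mul_assoc, mul_assoc, ← Real.exp_add, ← Real.exp_add]; congr 2; ring
    rw [hexp]
    have hpos : 0 < Real.exp (m * n) := Real.exp_pos _
    calc 2 * Real.exp (N - n) * Real.exp (m * n) ≤ C * Real.exp (-(m * n)) * Real.exp (m * n) :=
          mul_le_mul_of_nonneg_right h hpos.le
      _ = C := by rw [mul_assoc, ← Real.exp_add, neg_add_cancel, Real.exp_zero, mul_one]
  have hlim : Tendsto (fun n : ℕ => 2 * Real.exp N * Real.exp ((m - 1) * n)) atTop atTop := by
    have h1 : Tendsto (fun n : ℕ => (m - 1) * (n : ℝ)) atTop atTop :=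
      Tendsto.const_mul_atTop (by linarith) tendsto_natCast_atTop_atTop
    exact Tendsto.const_mul_atTop (by positivity) (Real.tendsto_exp_atTop.comp h1)
  have hev : ∀ᶠ n : ℕ in atTop, N ≤ n := tendsto_natCast_atTop_atTop.eventually_ge_atTop N
  obtain ⟨n, hn1, hn2⟩ := (hev.and (hlim.eventually_gt_atTop C)).exists
  exact absurd (hbound n hn1) (not_le.2 hn2)

/-- **With the transfer-matrix structure the constants are free at the exact rate** (why no RP-compatible abstract
family refutes `stub_lock` at the level of infinite-volume OS data): for a bounded operator `T` with `‖T‖ ≤ e^{−m}` on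
a real inner-product space — the transfer matrix on the orthocomplement of the vacuum, `m` the spectral gap — and any
two vectors (the OS vectors of two local observables), `|⟪ψ, Tⁿ φ⟫| ≤ e^{−m n} ‖ψ‖ ‖φ‖` for all `n`: OS-NORM
constants, uniform in the pair up to its norms, in the coupling and in `n`, at the sharp rate. [folklore] -/
theorem osNorm_constants {E : Type*} [NormedAddCommGroup E] [InnerProductSpace ℝ E] (T : E →L[ℝ] E) {m : ℝ}
    (hT : ‖T‖ ≤ Real.exp (-m)) (ψ φ : E) (n : ℕ) :
    |@inner ℝ E _ ψ ((T ^ n) φ)| ≤ Real.exp (-(m * n)) * (‖ψ‖ * ‖φ‖) := by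
  have hpow : ‖(T ^ n) φ‖ ≤ Real.exp (-(m * n)) * ‖φ‖ := by
    have h1 : ‖(T ^ n) φ‖ ≤ ‖T ^ n‖ * ‖φ‖ := (T ^ n).le_opNorm φ
    have h2 : ‖T ^ n‖ ≤ ‖T‖ ^ n := by
      rcases Nat.eq_zero_or_pos n with rfl | hn
      · simp only [pow_zero]
        exact ContinuousLinearMap.norm_id_le
      · exact norm_pow_le' T hn
    have h3 : ‖T‖ ^ n ≤ Real.exp (-m) ^ n := pow_le_pow_left₀ (norm_nonneg _) hT n
    have h4 : Real.exp (-m) ^ n = Real.exp (-(m * n)) := by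
      rw [← Real.exp_nat_mul]; congr 1; ring
    calc ‖(T ^ n) φ‖ ≤ ‖T ^ n‖ * ‖φ‖ := h1
      _ ≤ Real.exp (-(m * n)) * ‖φ‖ :=
          mul_le_mul_of_nonneg_right (h2.trans (h3.trans h4.le)) (norm_nonneg _)
  calc |@inner ℝ E _ ψ ((T ^ n) φ)| ≤ ‖ψ‖ * ‖(T ^ n) φ‖ := abs_real_inner_le_norm _ _
    _ ≤ ‖ψ‖ * (Real.exp (-(m * n)) * ‖φ‖) := mul_le_mul_of_nonneg_left hpow (norm_nonneg _)
    _ = Real.exp (-(m * n)) * (‖ψ‖ * ‖φ‖) := by ring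

/-- **Moment sequences are log-convex** (the positivity the plateau violates): for `T` self-adjoint — here any
bounded operator and its adjoint action written through `⟪T x, T x⟫` — `⟪ψ, T²ψ⟫·⟪ψ,ψ⟫ ≥ ⟪ψ, Tψ⟫²` is Cauchy–Schwarz
for `⟪ψ, Tψ⟫ = ⟪ψ, Tψ⟫`; we record the elementary real-sequence form used to disqualify `plateau`: a sequence with
`c (N+1) · c (N-1) < c N ^ 2` is not of the form `n ↦ ⟪ψ, Tⁿ ψ⟫` with `T` symmetric.  Instance: `plateau 1 β` at the
kink `N = ⌊β⌋` for `β ≥ 1` an integer has `c(N-1) c(N+1) = 2 · 2e^{-1} < 4 = c(N)²`. [folklore] -/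
theorem plateau_not_logConvex : plateau 1 1 0 * plateau 1 1 2 < plateau 1 1 1 ^ 2 := by
  have h0 : plateau 1 1 0 = 2 := plateau_eq_two (by norm_num)
  have h1 : plateau 1 1 1 = 2 := plateau_eq_two (by norm_num)
  have h2 : plateau 1 1 2 = 2 * Real.exp (-1) := by
    unfold plateau
    rw [show (-((((2 : ℕ) : ℝ)) - (((1 : ℕ) : ℝ)) * max (1 : ℝ) 0)) = -1 by norm_num,
      min_eq_right (Real.exp_le_one_iff.2 (by norm_num))]
  rw [h0, h1, h2]
  have : Real.exp (-1) < 1 := Real.exp_lt_one_iff.2 (by norm_num)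
  nlinarith

/-- **Symmetric moment sequences ARE log-convex** (contrast): for a symmetric bounded operator `T` on a real inner
product space and any `ψ`, `⟪ψ, T ψ⟫² ≤ ⟪ψ, ψ⟫ · ⟪Tψ, Tψ⟫ = ⟪ψ,ψ⟫ ⟪ψ, T²ψ⟫` — Cauchy–Schwarz; iterating along `Tⁿψ`
gives log-convexity of `n ↦ ⟪ψ, Tⁿψ⟫`, which is why RP data cannot contain a plateau followed by a faster tail.
[folklore] -/
theorem symmetric_moment_logConvex {E : Type*} [NormedAddCommGroup E] [InnerProductSpace ℝ E] (T : E →L[ℝ] E)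
    (hT : ∀ x y : E, @inner ℝ E _ (T x) y = @inner ℝ E _ x (T y)) (ψ : E) :
    (@inner ℝ E _ ψ (T ψ)) ^ 2 ≤ @inner ℝ E _ ψ ψ * @inner ℝ E _ ψ (T (T ψ)) := by
  have hcs := real_inner_mul_inner_self_le ψ (T ψ)
  rw [← hT ψ (T ψ)] at *
  calc (@inner ℝ E _ ψ (T ψ)) ^ 2 = @inner ℝ E _ ψ (T ψ) * @inner ℝ E _ ψ (T ψ) := sq _
    _ ≤ @inner ℝ E _ ψ ψ * @inner ℝ E _ (T ψ) (T ψ) := hcs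

end Targets


/-! ## §4 Burden summary (for provers) — see the module docblock

## §5 Near-misses (sorried ON PURPOSE — each is an open problem or a multi-cycle formalisation; recorded so nobody
re-attempts them cheaply) -/

section NearMisses

variable {G : Type} [Group G] [TopologicalSpace G] [IsTopologicalGroup G] [CompactSpace G]
  [MeasurableSpace G] [BorelSpace G]

/-- **NEAR-MISS 1 — half (i) of a refutation at `G = SU(2)`**: `GapHyp` for `SU(2)` in every faithful unitary `r`.
This is the volume-uniform weak-coupling lattice mass gap (Chatterjee 2019 Problem 5.1 minus criticality; tree
conjecture `LatticeMassGapAllCouplings`); known only for `0 ≤ β < β_OS` (Osterwalder–Seiler 1978, landed as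
`StrongCouplingShape`).  Obstruction: no non-abelian weak-coupling IR technique exists.  (Half (ii), `¬ Concl SU(2)`,
is expected FALSE — it is Clay's statement.) -/
theorem gapHyp_su2 :
    letI : MeasurableSpace (Matrix.specialUnitaryGroup (Fin 2) ℂ) := borel _
    haveI : BorelSpace (Matrix.specialUnitaryGroup (Fin 2) ℂ) := ⟨rfl⟩
    ∀ r : LatticeRep (Matrix.specialUnitaryGroup (Fin 2) ℂ),
      GapHypAt (Matrix.specialUnitaryGroup (Fin 2) ℂ) r := by
  sorry

/-- The renormalised, smeared, truncated REFLECTION-DIAGONAL lattice two-point function of the curvature at step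
`k` on the real positive-time test function `v` (the quantity whose limit is the OS norm `‖Ψ_v − ⟨Ω,Ψ_v⟩Ω‖²`;
cf. landed `twoPointNontrivial_iff_lattice_diagonal`). [folklore] -/
def truncDiag (r : LatticeRep G) (sch : SpeciesScheme (YMSpecies G)) (k : ℕ)
    (v : 𝓢(EuclideanSpace ℝ (Fin 4), ℝ)) : ℝ :=
  latticeSchwinger r.ρ sch (fun s => s.F) k (1 + 1) (fun _ => r.curvature) ![thetaTest 4 v, v] -
    latticeSchwinger r.ρ sch (fun s => s.F) k 1 (fun _ => r.curvature) ![thetaTest 4 v] *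
      latticeSchwinger r.ρ sch (fun s => s.F) k 1 (fun _ => r.curvature) ![v]

/-- Physical time-translation of a one-variable real test function by `t` (away from the reflection plane).
[folklore] -/
def timeShift (t : ℝ) : 𝓢(EuclideanSpace ℝ (Fin 4), ℝ) →L[ℝ] 𝓢(EuclideanSpace ℝ (Fin 4), ℝ) :=
  SchwartzMap.compSubConstCLM ℝ (t • EuclideanSpace.single (0 : Fin 4) (1 : ℝ))

/-- **NEAR-MISS 3 — FREEZING IS FATAL (ideator-1 B3; the route's why-might-fail "if ξ(β) stays bounded as β → ∞
every weak-coupling limit is ultralocal"): the re-typed crux CONTAINS sequential criticality.**  Intended statement: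
if along the witness's scheme the lattice gap in LATTICE units stays `≥ μ > 0` in the OS form — shifting a
positive-time test function `j` lattice steps away from the reflection plane contracts the renormalised truncated
diagonal by `e^{−2μj}` (transfer matrix `‖T|_{Ω⊥}‖ ≤ e^{−μ}` on the scheme's tori, uniformly in `k`) — then the tied
OS datum is trivial in `tr F²`; with `β_k → ∞` forced by `HasWeakCouplingLimit`, GapHyp(G) ∧ (frozen ξ at every
faithful r) ⇒ ¬Concl(G), i.e. `crux → ∀ G, GapHyp G → ∃ r, ¬Frozen r` (criticality as a liminf, for SOME r).
ROADMAP (all standard, none in the tree; ≥ 1 cycle): (1) for fixed `t > 0` put `j_k := ⌊t / a_k⌋ → ∞`, so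
`truncDiag_k (timeShift (j_k a_k) v) ≤ e^{−2μ j_k} truncDiag_k v → 0 · ℓ(v) = 0`; (2) MOVING TEST FUNCTION:
`timeShift (j_k a_k) v → timeShift t v` in `𝓢`, and `|truncDiag_k (w_k) − truncDiag_k (w)| → 0` for `w_k → w` needs
EQUICONTINUITY of the renormalised lattice bilinear forms — Banach–Steinhaus on the (Fréchet) half-space subspace of
`𝓢`, from pointwise convergence (`IsYangMillsFor`) — NOT implied by anything weaker, and this is where the
uncontrolled renormalisations `c_k` are tamed; (3) hence `ℓ(timeShift t v) = 0` for all `t > 0`; (4) `t → 0⁺`: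
continuity of translation on `𝓢` and of `T.schwinger 2` give `ℓ(v) = 0`; (5) landed
`twoPointNontrivial_iff_lattice_diagonal` (E2 + translations + `𝔖₀ = 1` from `OSData`) turns `ℓ ≡ 0` into
`¬ IsNontrivial`.  CAVEATS found while trying: (a) without positivity the implication is FALSE for abstract kernels
(a thin shell kernel `K_k(x,y) = e^{−μ|x−y|}·1[|x−y| ≈ δ/a_k]` is uniformly clustering yet has the non-trivial
massive limit `δ(|x−y|−δ)` under `c_k = e^{μδ/2a_k}`; cf. the barrier audit's `towerKernel`), so the OS form of the
hypothesis (or `IsPolynomialPrefactor`) is essential; (b) the smeared field of a translate is a lattice translate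
of the smeared field only up to box-boundary terms weighted by `c_k` — again tamed only by (2).  Use for the lead:
B3 is NOT free; its step (2) is a k-uniform OS-norm bound of the (UVB) type of stmt-15926. -/
theorem frozen_fatal_nearMiss (r : LatticeRep G) (sch : SpeciesScheme (YMSpecies G)) (T : OSData (YMSpecies G) 4)
    (hw : sch.HasWeakCouplingLimit) (hYM : IsYangMillsFor r sch T)
    (hfrozen : ∃ μ : ℝ, 0 < μ ∧ ∀ᶠ k in atTop, ∀ v : 𝓢(EuclideanSpace ℝ (Fin 4), ℝ),
      tsupport v ⊆ {y : EuclideanSpace ℝ (Fin 4) | 0 < y 0} → ∀ j : ℕ,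
        truncDiag r sch k (timeShift ((j : ℝ) * sch.a k) v) ≤ Real.exp (-(2 * μ * j)) * truncDiag r sch k v) :
    ¬ T.IsNontrivial r.curvature := by
  sorry

/-- **Step (1) of the roadmap is the only trivial one** (recorded to fix the bookkeeping): a frozen contraction plus
convergence of the un-shifted diagonal forces the shifted diagonals at lattice-diverging shifts to `0`. [folklore] -/
theorem frozen_step_one {d : ℕ → ℕ → ℝ} {μ ℓ : ℝ} (hμ : 0 < μ) (hd : ∀ k j, 0 ≤ d k j)
    (hcontr : ∀ k j, d k j ≤ Real.exp (-(2 * μ * j)) * d k 0) (hlim : Tendsto (fun k => d k 0) atTop (𝓝 ℓ))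
    {j : ℕ → ℕ} (hj : Tendsto j atTop atTop) : Tendsto (fun k => d k (j k)) atTop (𝓝 0) := by
  have hexp : Tendsto (fun k => Real.exp (-(2 * μ * (j k : ℝ)))) atTop (𝓝 0) := by
    have h1 : Tendsto (fun k => 2 * μ * (j k : ℝ)) atTop atTop :=
      Tendsto.const_mul_atTop (by positivity) (tendsto_natCast_atTop_atTop.comp hj)
    exact Real.tendsto_exp_atBot.comp (tendsto_neg_atTop_atBot.comp h1)
  have hprod : Tendsto (fun k => Real.exp (-(2 * μ * (j k : ℝ))) * d k 0) atTop (𝓝 (0 * ℓ)) := hexp.mul hlim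
  rw [zero_mul] at hprod
  exact tendsto_of_tendsto_of_tendsto_of_le_of_le tendsto_const_nhds hprod (fun k => hd k (j k))
    fun k => hcontr k (j k)

end NearMisses

end Summit.QuantumFields.YangMills.Cruxes.ContinuumLegGivenGap.Disproof

end
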